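import Mathlib
import HarnessLib
import Summits.HubbardSuperconductivity.HubbardSuperconductivity.Theorems.BalabanIRBirEveryGroundStateStubNoJointEigenGroundDoublonFree
import Summits.HubbardSuperconductivity.HubbardSuperconductivity.Theorems.EnslavedA1gPairChemicalPotentialWindowLemmas
import Summits.HubbardSuperconductivity.HubbardSuperconductivity.Theorems.WeakCouplingBCSWcbcsSsbToTorusLROMomentClosure
import Literature.MathematicalPhysics.QuantumLattice.PairFieldMomentum
import Literature.MathematicalPhysics.QuantumLattice.ApproximateEigenvectorLemmas

/-!
# Crux `WindowInfraredBound` (stmt-HubbardSuperconductivity-1089) — the `η`-channel calibration, part 1: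
# Yang's commutator momentum-resolved, and the `η`-gap domination `γ ‖Δ_s(p)ψ‖ ≤ 2|t| ‖Δ_{s*}(p)ψ‖`

STRATEGY-CENSUS §7 R4 / idea `annihilator-eom-pole-one` (triage r2, both triagers: "(ηWB) true, salvage as support").
For the Hubbard torus `H = hubbardTorus 2 L t U` and Scalapino's pair fields `Δ_g(p) = pairFieldAt g L p`
(`s = sWave`: the on-site pair `√2 c_{x↑}c_{x↓}`, i.e. Yang's `η` mode up to `√2`; `s* = extendedSWave`):

* `hamiltonian_commutator_onSitePairAnnihilator` (any finite graph), `hubbardTorus_commutator_localPair_sWave`,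
  `hubbardTorus_commutator_pairFieldAt_sWave` — the exact, momentum-resolved Yang commutator
  `[H, Δ_s(p)] = 2t Δ_{s*}(p) − U Δ_s(p)`: the on-site pair field is an approximate LOWERING EIGEN-OPERATOR of `H`
  (eigenvalue `−U`) whose kinetic remainder is the extended-`s` pair field (on sites `[H, P^s_x] = 2t P^{s*}_x − U P^s_x`);
* `eucNorm_mulVec_le_of_approxLowering` — the one-sided KKT lever: for Hermitian `H`, `Hψ = Eψ`, `Bψ ∈ K'`,
  `(ω − (E − minEnergyOn H K')) ‖Bψ‖ ≤ ‖(HB − BH + ωB)ψ‖` (variational principle in `K'` + Cauchy–Schwarz);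
* `etaGap_mul_eucNorm_pairFieldAt_sWave_le`, closed form `etaGapDomination` (registered support) — in every
  `(N, S^z = M)`-sector ground state, `N ≥ 2`, at EVERY momentum `p`:
  `(U − (E_N − E_{N−2})) · ‖Δ_s(p)ψ‖ ≤ 2|t| · ‖Δ_{s*}(p)ψ‖`, `E_K = minEnergyOn H (szSector K M)`.

Part 2 (`…EtaWindowBound.lean`) adds the kinematic fact that the extended-`s` weight vanishes at `Q = (π,π)` and
concludes the FLAT window law `Σ_{q≠0,|q|≤ε} S^s_ψ(Q+q) ≤ 32 t² ε² L²/(U − (E_N − E_{N−2}))²` under the `η`-gap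
hypothesis. This is the momentum-resolved, canonical-sector form of Shastry's pair-projection inequality (tree:
`shastry_pair_projection_inequalities_holds`, uniform mode, grand canonical). It does not touch the crux itself
(the `d`-wave pair field has no lowering eigen-operator; its window law is the Goldstone `C ε L²`, pole order one).
Sources: C. N. Yang, PRL 63 (1989) 2144, eqs. (4)–(6); B. S. Shastry, J. Phys. A 30 (1997) L635, Ineqs. (3)–(5);
L. Pitaevskii, S. Stringari, J. Low Temp. Phys. 85 (1991) 377; D. J. Scalapino, Phys. Rep. 250 (1995) 329, §2.
Folklore finite-dimensional bookkeeping over the tree's definitions; no definition and no named fact is introduced.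
-/

noncomputable section

-- the mandated namespace repeats `HubbardSuperconductivity` (single-problem summit, D-0017)
set_option linter.dupNamespace false

namespace Summit.HubbardSuperconductivity.HubbardSuperconductivity.Theorems.WindowInfraredBound

open Matrix Finset
open Literature.Probability.LatticeModels Literature.MathematicalPhysics.QuantumLattice
open Literature.MathematicalPhysics.QuantumLattice.EigenvalueContinuation (re_star_dotProduct_self_nonneg)
open scoped ComplexOrder ComplexConjugate Matrix.Norms.L2Operator

/-! ## §1 Yang's commutator, momentum-resolved: `[H, Δ_s(p)] = 2t Δ_{s*}(p) − U Δ_s(p)` -/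

section Graph

variable {Λ : Type*} [LinearOrder Λ] [Fintype Λ] (G : SimpleGraph Λ) [DecidableRel G.Adj]

/-- **`[H(t,U), c_{z↑} c_{z↓}] = t Σ_{y ∼ z} (c_{z↑}c_{y↓} − c_{z↓}c_{y↑}) − U c_{z↑}c_{z↓}`** on any finite graph:
the on-site pair annihilator is a lowering eigen-operator of the interaction (`[Σ_x n_{x↑}n_{x↓}, c_{z↑}c_{z↓}]
= −c_{z↑}c_{z↓}`) and its kinetic commutator is the local singlet-bond annihilator around `z`. From the tree's
one-fermion commutator `[H, c_{zτ}] = t Σ_{y∼z} c_{yτ} − U n_{zτ̄} c_{zτ}` and `n_{z↓}c_{z↑}c_{z↓} = 0`,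
`c_{z↑}n_{z↑} = c_{z↑}`. Yang, PRL 63 (1989) 2144, eqs. (4)–(6). [cite: Yang1989, eqs. (4)–(6)] -/
theorem hamiltonian_commutator_onSitePairAnnihilator (t U : ℝ) (z : Λ) :
    hamiltonian G t U * (annihilation (orb z 0) * annihilation (orb z 1)) -
        annihilation (orb z 0) * annihilation (orb z 1) * hamiltonian G t U =
      (t : ℂ) • (∑ y ∈ univ.filter (fun y => G.Adj z y),
          (annihilation (orb z 0) * annihilation (orb y 1) - annihilation (orb z 1) * annihilation (orb y 0))) -
        (U : ℂ) • (annihilation (orb z 0) * annihilation (orb z 1)) := by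
  set H := hamiltonian G t U with hH
  set a : Matrix (Finset (Orb Λ)) (Finset (Orb Λ)) ℂ := annihilation (orb z 0) with ha
  set b : Matrix (Finset (Orb Λ)) (Finset (Orb Λ)) ℂ := annihilation (orb z 1) with hb
  have h0 := EnslavedA1g.hamiltonian_commutator_annihilation G t U z (τ := 0) (τ' := 1) (by decide)
  have h1 := EnslavedA1g.hamiltonian_commutator_annihilation G t U z (τ := 1) (τ' := 0) (by decide)
  rw [← hH, ← ha] at h0
  rw [← hH, ← hb] at h1
  -- `[H, ab] = [H,a] b + a [H,b]`
  have hexp : H * (a * b) - a * b * H = (H * a - a * H) * b + a * (H * b - b * H) := by noncomm_ring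
  -- `n_{z↓} (a b) = a n_{z↓} b = 0`, `a n_{z↑} b = a b`
  have hn1 : numberOp z 1 * (a * b) = 0 := by
    rw [← mul_assoc, ha, hb, numberOp_mul_annihilation_of_ne' (orb_zero_ne_orb_one' z).symm, mul_assoc,
      numberOp_mul_annihilation_self', mul_zero]
  have hn0 : a * (numberOp z 0 * b) = a * b := by
    rw [← mul_assoc, ha, annihilation_mul_numberOp_self']
  -- the two hopping pieces combine to the singlet bonds
  have hXY : (∑ y ∈ univ.filter (fun y => G.Adj z y), annihilation (orb y 0)) * b +
      a * (∑ y ∈ univ.filter (fun y => G.Adj z y), annihilation (orb y 1)) =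
      ∑ y ∈ univ.filter (fun y => G.Adj z y), (a * annihilation (orb y 1) - b * annihilation (orb y 0)) := by
    rw [Finset.sum_mul, Finset.mul_sum, ← Finset.sum_add_distrib]
    refine Finset.sum_congr rfl fun y _ => ?_
    rw [hb, LiebThm1.annihilation_mul_annihilation_eq_neg (orb y 0) (orb z 1), neg_add_eq_sub]
  have key : (H * a - a * H) * b + a * (H * b - b * H) =
      (t : ℂ) • ((∑ y ∈ univ.filter (fun y => G.Adj z y), annihilation (orb y 0)) * b +
        a * (∑ y ∈ univ.filter (fun y => G.Adj z y), annihilation (orb y 1))) - (U : ℂ) • (a * b) := by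
    rw [h0, h1]
    simp only [sub_mul, mul_sub, smul_mul_assoc, mul_smul_comm, mul_assoc, hn1, hn0, smul_zero, sub_zero, smul_add]
    abel
  rw [hexp, key, hXY]

end Graph

section Torus

variable {L : ℕ} [NeZero L]

omit [NeZero L] in
/-- `Torus.proj L 0 = 0`. [folklore] -/
theorem ewb_torusProj_zero : Torus.proj (d := 2) L (0 : Site 2) = 0 := by
  funext i
  simp [Torus.proj]

/-- **The on-site pair of the tree is `√2 c_{x↑} c_{x↓}`**: `localPair sWave L x = (1/√2)(c_{x↑}c_{x↓} − c_{x↓}c_{x↑})`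
(only the step `e = 0` of `{0} ∪ unitSteps` carries the `s`-wave form factor). Scalapino (1995) §2 eq. (2.2). [folklore] -/
theorem localPair_sWave_eq (x : TorusSite 2 L) :
    localPair sWave L x = ((1 / Real.sqrt 2 : ℝ) : ℂ) •
      (annihilation (orb (FermionTorus.ofTorusSite x) 0) * annihilation (orb (FermionTorus.ofTorusSite x) 1) -
        annihilation (orb (FermionTorus.ofTorusSite x) 1) * annihilation (orb (FermionTorus.ofTorusSite x) 0)) := by
  rw [localPair, Finset.sum_insert zero_not_mem_unitSteps, ewb_torusProj_zero, add_zero,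
    show sWave 0 = 1 from if_pos rfl, Finset.sum_eq_zero fun e he => ?_, add_zero]
  have hs : sWave e = 0 := by
    rw [sWave, if_neg]
    rintro rfl
    exact zero_not_mem_unitSteps he
  rw [hs, zero_div, Complex.ofReal_zero, zero_smul]

/-- `c_{x↑}c_{x↓} − c_{x↓}c_{x↑} = 2 c_{x↑}c_{x↓}`. Bratteli–Robinson II §5.2.2. [folklore] -/
theorem ewb_pair_sub_swap_eq_two_smul {Λ : Type*} [LinearOrder Λ] [Fintype Λ] (z : Λ) :
    (annihilation (orb z 0) * annihilation (orb z 1) - annihilation (orb z 1) * annihilation (orb z 0) :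
        Matrix (Finset (Orb Λ)) (Finset (Orb Λ)) ℂ) =
      (2 : ℂ) • (annihilation (orb z 0) * annihilation (orb z 1)) := by
  rw [LiebThm1.annihilation_mul_annihilation_eq_neg (orb z 1) (orb z 0), sub_neg_eq_add, two_smul]

/-- **On sites: `[H, P^s_x] = 2t P^{s*}_x − U P^s_x`** for the Hubbard torus (`L ≥ 3`, any `t`, `U`): the on-site pair
`P^s_x = localPair sWave L x` is a lowering eigen-operator of the interaction and its kinetic commutator is `2t` times
the extended-`s` pair `P^{s*}_x = localPair extendedSWave L x` (the singlet bonds around `x`,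
`localPair_extendedSWave_eq_smul_sum_adj`). Yang, PRL 63 (1989) 2144, eq. (6). [cite: Yang1989, eq. (6)] -/
theorem hubbardTorus_commutator_localPair_sWave (hL : 3 ≤ L) (t U : ℝ) (x : TorusSite 2 L) :
    hubbardTorus 2 L t U * localPair sWave L x - localPair sWave L x * hubbardTorus 2 L t U =
      ((2 * t : ℝ) : ℂ) • localPair extendedSWave L x - (U : ℂ) • localPair sWave L x := by
  have hc := hamiltonian_commutator_onSitePairAnnihilator (fermionTorusGraph 2 L) t U (FermionTorus.ofTorusSite x)
  rw [Finset.sum_filter] at hc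
  set X : Matrix (Finset (Orb (FermionTorus 2 L))) (Finset (Orb (FermionTorus 2 L))) ℂ :=
    ∑ y, if (fermionTorusGraph 2 L).Adj (FermionTorus.ofTorusSite x) y then
      (annihilation (orb (FermionTorus.ofTorusSite x) 0) * annihilation (orb y 1) -
        annihilation (orb (FermionTorus.ofTorusSite x) 1) * annihilation (orb y 0)) else 0 with hX
  set Y : Matrix (Finset (Orb (FermionTorus 2 L))) (Finset (Orb (FermionTorus 2 L))) ℂ :=
    annihilation (orb (FermionTorus.ofTorusSite x) 0) * annihilation (orb (FermionTorus.ofTorusSite x) 1) with hY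
  set Hm := hamiltonian (fermionTorusGraph 2 L) t U with hHm
  rw [localPair_extendedSWave_eq_smul_sum_adj L hL x, localPair_sWave_eq, ewb_pair_sub_swap_eq_two_smul, hubbardTorus,
    ← hX, ← hY, ← hHm]
  have hlhs : Hm * (((1 / Real.sqrt 2 : ℝ) : ℂ) • (2 : ℂ) • Y) - (((1 / Real.sqrt 2 : ℝ) : ℂ) • (2 : ℂ) • Y) * Hm =
      (((1 / Real.sqrt 2 : ℝ) : ℂ) * 2) • (Hm * Y - Y * Hm) := by
    rw [smul_smul, mul_smul_comm, smul_mul_assoc, ← smul_sub]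
  rw [hlhs, hc]
  simp only [smul_sub, smul_smul]
  push_cast
  congr 1
  · congr 1
    ring
  · congr 1
    ring

/-- **Yang's commutator, momentum-resolved: `[H, Δ_s(p)] = 2t Δ_{s*}(p) − U Δ_s(p)`** for every momentum label `p`
(`Δ_g(p) = pairFieldAt g L p = Σ_x conj χ_p(x) P^g_x`; sum the site identity with the phases). At `p = Q = (π,π)` on
an even torus `Δ_{s*}(Q) ψ`-weights cancel (below), recovering `[H, η_Q] = −U η_Q`. Yang, PRL 63 (1989) 2144, eq. (6);
Shastry, J. Phys. A 30 (1997) L635 (`[H̃, B] = A − (U − 2μ)B`). [cite: Yang1989, eq. (6)] -/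
theorem hubbardTorus_commutator_pairFieldAt_sWave (hL : 3 ≤ L) (t U : ℝ) (p : TorusSite 2 L) :
    hubbardTorus 2 L t U * pairFieldAt sWave L p - pairFieldAt sWave L p * hubbardTorus 2 L t U =
      ((2 * t : ℝ) : ℂ) • pairFieldAt extendedSWave L p - (U : ℂ) • pairFieldAt sWave L p := by
  simp only [pairFieldAt_eq_sum_torusChar, Finset.mul_sum, Finset.sum_mul, mul_smul_comm, smul_mul_assoc,
    ← Finset.sum_sub_distrib, ← smul_sub, hubbardTorus_commutator_localPair_sWave hL, Finset.smul_sum]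
  refine Finset.sum_congr rfl fun x _ => ?_
  rw [smul_sub, smul_comm _ ((2 * t : ℝ) : ℂ), smul_comm _ (U : ℂ)]

end Torus

/-! ## §2 The one-sided KKT lever and the pointwise domination `γ ‖Δ_s(p)ψ‖ ≤ 2|t| ‖Δ_{s*}(p)ψ‖` -/

section Lever

variable {ι : Type*} [Fintype ι]

/-- **One-sided KKT with an approximate lowering eigen-operator.** For a Hermitian `H`, any matrix `B`, any real
`ω`, and an eigenvector `H ψ = E ψ` such that `B ψ` lies in a subspace `K'` with bottom `E' = minEnergyOn H K'`:
`(ω − (E − E')) · ‖Bψ‖ ≤ ‖(H B − B H + ω B) ψ‖` — the eigenvector is almost annihilated by any operator that almost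
satisfies a lowering equation of motion `[H, B] ≈ −ω B` across the two bottoms (variational principle in `K'` plus
Cauchy–Schwarz; no sign hypothesis on `ω`). Pitaevskii–Stringari, J. Low Temp. Phys. 85 (1991) 377 (one-sided
`T = 0` inequalities); Shastry, J. Phys. A 30 (1997) L635, Ineqs. (3)–(5). [folklore] -/
theorem eucNorm_mulVec_le_of_approxLowering {H : Matrix ι ι ℂ} (K' : Submodule ℂ (ι → ℂ)) (B : Matrix ι ι ℂ)
    {ψ : ι → ℂ} {E : ℝ} (ω : ℝ) (hHψ : H *ᵥ ψ = (E : ℂ) • ψ) (hB : B *ᵥ ψ ∈ K') :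
    (ω - (E - H.minEnergyOn K')) * eucNorm (B *ᵥ ψ) ≤ eucNorm ((H * B - B * H + (ω : ℂ) • B) *ᵥ ψ) := by
  -- adapted from Cruxes/WindowInfraredBound/SketchIdeator4.lean (crux-ideate r2, idea annihilator-eom-pole-one)
  set v : ι → ℂ := B *ᵥ ψ with hv
  set w : ι → ℂ := (H * B - B * H + (ω : ℂ) • B) *ᵥ ψ with hw
  -- the remainder applied to `ψ` is `H v + (ω − E) v`
  have hw' : w = H *ᵥ v + ((ω - E : ℝ) : ℂ) • v := by
    simp only [hw, hv, add_mulVec, sub_mulVec, smul_mulVec, ← mulVec_mulVec, hHψ, mulVec_smul,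
      Complex.ofReal_sub]
    rw [sub_smul]
    abel
  -- variational principle in `K'`
  have hvar : H.minEnergyOn K' * (star v ⬝ᵥ v).re ≤ (star v ⬝ᵥ H *ᵥ v).re := minEnergyOn_mul_re_le H K' hB
  -- `re ⟨v, w⟩ ≥ (ω − (E − E')) ‖v‖²`
  have hre : (ω - (E - H.minEnergyOn K')) * eucNorm v ^ 2 ≤ (star v ⬝ᵥ w).re := by
    rw [hw', dotProduct_add, dotProduct_smul, Complex.add_re, smul_eq_mul, Complex.re_ofReal_mul, eucNorm_sq]
    nlinarith [hvar, re_star_dotProduct_self_nonneg v]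
  -- Cauchy–Schwarz
  have hcs : (star v ⬝ᵥ w).re ≤ eucNorm v * eucNorm w :=
    (Complex.re_le_norm _).trans (norm_star_dotProduct_le v w)
  have hv0 : 0 ≤ eucNorm v := eucNorm_nonneg v
  have hw0 : 0 ≤ eucNorm w := eucNorm_nonneg w
  rcases hv0.eq_or_lt with h0 | hpos
  · rw [← h0, mul_zero]
    exact hw0
  · have : (ω - (E - H.minEnergyOn K')) * eucNorm v * eucNorm v ≤ eucNorm w * eucNorm v := by
      nlinarith [hre, hcs]
    exact le_of_mul_le_mul_right this hpos

end Lever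

section Pointwise

variable {L : ℕ} [NeZero L]

/-- **`η`-gap domination, pointwise in momentum.** In every `(N, S^z = M)`-sector ground state `ψ` of the Hubbard
torus (`L ≥ 3`, `N ≥ 2`, any `t`, `U`, `M`) and at EVERY momentum label `p`,
`(U − (E_N − E_{N−2})) · ‖Δ_s(p)ψ‖ ≤ 2|t| · ‖Δ_{s*}(p)ψ‖`, `E_K = minEnergyOn H (szSector K M)`: the on-site pair
weight is controlled by the extended-`s` pair weight as soon as the pair-removal energy is below `U` (the lever
`eucNorm_mulVec_le_of_approxLowering` with `B = Δ_s(p)`, `ω = U`, `K' = szSector (N−2) M`, and Yang's commutator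
`[H, Δ_s(p)] + U Δ_s(p) = 2t Δ_{s*}(p)`). Shastry, J. Phys. A 30 (1997) L635, Ineq. (5) (uniform mode, grand
canonical); Yang, PRL 63 (1989) 2144. [cite: Shastry1997, Ineq. (5)] -/
theorem etaGap_mul_eucNorm_pairFieldAt_sWave_le (hL : 3 ≤ L) (t U : ℝ) {N : ℕ} (hN : 2 ≤ N) {M : ℝ}
    {ψ : Fock (Orb (FermionTorus 2 L))} (hgs : IsGroundStateInSector (hubbardTorus 2 L t U) N M ψ)
    (p : TorusSite 2 L) :
    (U - ((hubbardTorus 2 L t U).minEnergyOn (szSector N M) -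
        (hubbardTorus 2 L t U).minEnergyOn (szSector (N - 2) M))) * eucNorm (pairFieldAt sWave L p *ᵥ ψ) ≤
      2 * |t| * eucNorm (pairFieldAt extendedSWave L p *ᵥ ψ) := by
  have hlev := eucNorm_mulVec_le_of_approxLowering (H := hubbardTorus 2 L t U)
    (szSector (Λ := FermionTorus 2 L) (N - 2) M) (pairFieldAt sWave L p) U hgs.2.2
    (WcbcsSsbToTorusLRO.pairFieldAt_mulVec_mem_szSector sWave p hN hgs.1)
  have hrem : hubbardTorus 2 L t U * pairFieldAt sWave L p - pairFieldAt sWave L p * hubbardTorus 2 L t U +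
      (U : ℂ) • pairFieldAt sWave L p = ((2 * t : ℝ) : ℂ) • pairFieldAt extendedSWave L p := by
    rw [hubbardTorus_commutator_pairFieldAt_sWave hL, sub_add_cancel]
  rw [hrem, smul_mulVec, eucNorm_smul, Complex.norm_real, Real.norm_eq_abs, abs_mul, abs_two] at hlev
  linarith [hlev]

end Pointwise

section Registered

/-- **`η`-GAP DOMINATION** (registered support of crux `WindowInfraredBound`; closed form of
`etaGap_mul_eucNorm_pairFieldAt_sWave_le`). For every torus side `L ≥ 3`, every `t`, `U`, `N ≥ 2`, `M`, every
`(N, S^z = M)`-sector ground state `ψ` of `hubbardTorus 2 L t U` and EVERY momentum label `p`: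
`(U − (E_N − E_{N−2})) · ‖Δ_s(p)ψ‖ ≤ 2|t| · ‖Δ_{s*}(p)ψ‖` — the on-site pair weight at any momentum is controlled
by the extended-`s` pair weight at the same momentum once the pair-removal energy is below `U` (one KKT inequality
with a lowering eigen-operator; no reflection positivity). Shastry, J. Phys. A 30 (1997) L635, Ineq. (5);
Yang, PRL 63 (1989) 2144, eq. (6). [cite: Shastry1997, Ineq. (5)] -/
theorem etaGapDomination : ∀ (L : ℕ) [NeZero L], 3 ≤ L → ∀ (t U : ℝ) (N : ℕ), 2 ≤ N →
    ∀ (M : ℝ) (ψ : Fock (Orb (FermionTorus 2 L))), IsGroundStateInSector (hubbardTorus 2 L t U) N M ψ →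
    ∀ p : TorusSite 2 L,
      (U - ((hubbardTorus 2 L t U).minEnergyOn (szSector (Λ := FermionTorus 2 L) N M) -
          (hubbardTorus 2 L t U).minEnergyOn (szSector (Λ := FermionTorus 2 L) (N - 2) M))) *
          eucNorm (pairFieldAt sWave L p *ᵥ ψ) ≤
        2 * |t| * eucNorm (pairFieldAt extendedSWave L p *ᵥ ψ) :=
  fun _ _ hL t U _ hN _ _ hgs p => etaGap_mul_eucNorm_pairFieldAt_sWave_le hL t U hN hgs p

end Registered

end Summit.HubbardSuperconductivity.HubbardSuperconductivity.Theorems.WindowInfraredBound
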